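/-
Copyright: internal research formalization. Source texts: G. Kempf, F. Knudsen, D. Mumford,
B. Saint-Donat, Toroidal Embeddings I (LNM 339, Springer 1973) [KempfEtAl1973], Ch. I §2, Theorems
9–11 and the proof of Theorem 11 ((2): the associated polyhedra of the final function are exactly the
simplices; p. 18: "for each `α` there exist `r_i ∈ M` such that `f(x) = min_i ⟨r_i, x⟩` for
`x ∈ σ_α`"); W. Fulton, Introduction to Toric Varieties [Fulton1993Toric], §1.2 (exposed faces),
§2.6 p. 48.
-/
import Mathlib
import HarnessLib
import Literature.Geometry.PolyhedralFans.StrictSupport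
import Literature.Geometry.PolyhedralFans.RelativeProjectiveRefinement

/-!
# Support functions on fans, V: the tight form of the relative projective refinement

Topic: `Literature/Geometry/PolyhedralFans`. Part III (`StrictSupport`) turns `Fan.SupportData`
into the consumer interface `Fan.IsStrictSupport` (cone-indexed pieces whose minimum locus on every
cone is exactly the cone) by **tightening** with the constant `tightM`; Part IV
(`RelativeProjectiveRefinement`) proves [KempfEtAl1973] I §2 Thm. 11 for an arbitrary rational fan
`Δ` with ONE global order function `f`. Here the two are combined: tightening works for EVERY
constant `M ≥ tightM`, so one constant serves all cones of `Δ`, and the global order function of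
Part IV yields, on every cone `σ` of `Δ`, tight integral strict support data on the cones of the
regular refinement inside `σ`, non-negative on `σ`, whose minimum function is THE SAME global `f`
on every `σ` (so the cone-wise data are compatible on common faces).

## Content (all PROVED; no named facts, no new definitions)

* `Fan.SupportData.tight_local_of_const`, `tight_lt_at_gen_of_le`, `tight_global_of_le`,
  `isStrictSupport_tight_of_le` — the tightening of Part III for any constant `M ≥ tightM`
  (pieces `M a_ρ + ℓ_ρ`);
* **`Fan.exists_regular_refinement_isStrictSupport_cones`** — [KempfEtAl1973] I §2 Thm. 11 for an
  arbitrary rational fan in the tight form: a regular simplicial refinement `Δ' = Δ.starIter l` by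
  lattice star subdivisions and ONE `f ≥ 0` such that for every cone `σ` of `Δ` the fan
  `Δ'.restrict σ` (support `σ`) carries `m_σ` with `Fan.IsStrictSupport`, all `m_σ τ` integral and
  `≥ 0` on `σ`, and `⟨m_σ τ, x⟩ = f x` for `x ∈ τ`.
-/

noncomputable section

namespace Literature.Geometry.PolyhedralFans

open PointedCone Finset Matrix

variable {𝕜 : Type*} [Field 𝕜] [LinearOrder 𝕜] [IsStrictOrderedRing 𝕜]
variable {κ : Type*} [Fintype κ]

/-! ## Tightening with a prescribed constant -/

namespace Fan.SupportData

variable {Δ : Fan 𝕜 (κ → 𝕜)} (D : Δ.SupportData)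

/-- Inside the linearity domain of `a_ρ`, for ANY constant `M`: `M f ≤ ⟨M a_ρ + ℓ_ρ, ·⟩`, with
equality exactly on `ρ` (`ℓ_ρ` exposes `ρ` in the domain). [cite: KempfEtAl1973, I §2 Thm. 11 proof (2)] -/
theorem tight_local_of_const (M : 𝕜) {ρ : PointedCone 𝕜 (κ → 𝕜)} (hρ : ρ ∈ Δ.cones) {x : κ → 𝕜}
    (hx : x ∈ D.domain ρ) :
    M * D.f x ≤ (M • D.piece ρ + D.tightExpose ρ) ⬝ᵥ x ∧
      (M * D.f x = (M • D.piece ρ + D.tightExpose ρ) ⬝ᵥ x ↔ x ∈ ρ) := by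
  have hfx : D.f x = D.piece ρ ⬝ᵥ x := ((D.mem_domain_iff hρ).mp hx).2
  rw [add_dotProduct, smul_dotProduct, smul_eq_mul, ← hfx]
  have h0 := D.tightExpose_nonneg hρ hx
  refine ⟨by linarith, ?_⟩
  rw [← D.tightExpose_eq_zero_iff hρ hx]
  constructor
  · intro h; linarith
  · intro h; rw [h, add_zero]

/-- At a generator off the domain, for every `M ≥ tightM`: `M f < ⟨M a_ρ + ℓ_ρ, ·⟩` strictly.
[cite: KempfEtAl1973, I §2 Thm. 11 proof (2)] -/
theorem tight_lt_at_gen_of_le {M : 𝕜} (hM : D.tightM ≤ M) {ρ : PointedCone 𝕜 (κ → 𝕜)}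
    (hρ : ρ ∈ Δ.cones) {g : κ → 𝕜} (hg : g ∈ tightGens Δ) (hgs : g ∈ Δ.support)
    (hgD : g ∉ D.domain ρ) : M * D.f g < (M • D.piece ρ + D.tightExpose ρ) ⬝ᵥ g := by
  have hd : 0 < D.piece ρ ⬝ᵥ g - D.f g := by
    have := D.lt_piece_of_not_mem_domain hρ hgs hgD
    linarith
  have h1 := D.tight_lt_at_gen hρ hg hgs hgD
  rw [tightPiece, add_dotProduct, smul_dotProduct, smul_eq_mul] at h1
  rw [add_dotProduct, smul_dotProduct, smul_eq_mul]
  have h2 : D.tightM * (D.piece ρ ⬝ᵥ g - D.f g) ≤ M * (D.piece ρ ⬝ᵥ g - D.f g) :=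
    mul_le_mul_of_nonneg_right hM hd.le
  rw [mul_sub, mul_sub] at h2
  linarith

/-- At any generator, for every `M ≥ tightM`: `M f ≤ ⟨M a_ρ + ℓ_ρ, ·⟩`.
[cite: KempfEtAl1973, I §2 Thm. 11 proof (2)] -/
theorem tight_le_at_gen_of_le {M : 𝕜} (hM : D.tightM ≤ M) {ρ : PointedCone 𝕜 (κ → 𝕜)}
    (hρ : ρ ∈ Δ.cones) {g : κ → 𝕜} (hg : g ∈ tightGens Δ) (hgs : g ∈ Δ.support) :
    M * D.f g ≤ (M • D.piece ρ + D.tightExpose ρ) ⬝ᵥ g := by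
  by_cases hgD : g ∈ D.domain ρ
  · exact (D.tight_local_of_const M hρ hgD).1
  · exact (D.tight_lt_at_gen_of_le hM hρ hg hgs hgD).le

/-- **Global comparison for the tight pieces with any constant `M ≥ tightM`**: on the support
`M f ≤ ⟨M a_ρ + ℓ_ρ, ·⟩`, with equality only on `ρ` (the proof of `tight_global` of Part III with
the constant generalised). [cite: KempfEtAl1973, I §2 Thm. 11 proof (2)] -/
theorem tight_global_of_le {M : 𝕜} (hM : D.tightM ≤ M) {ρ : PointedCone 𝕜 (κ → 𝕜)}
    (hρ : ρ ∈ Δ.cones) {x : κ → 𝕜} (hx : x ∈ Δ.support) :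
    M * D.f x ≤ (M • D.piece ρ + D.tightExpose ρ) ⬝ᵥ x ∧
      (M * D.f x = (M • D.piece ρ + D.tightExpose ρ) ⬝ᵥ x → x ∈ ρ) := by
  classical
  obtain ⟨ρ', hρ', hxρ'⟩ := Fan.mem_support.mp hx
  have hfg' : ρ'.FG := Δ.fg hρ'
  have hxh : x ∈ PointedCone.hull 𝕜 ((gens ρ' : Finset (κ → 𝕜)) : Set (κ → 𝕜)) := by
    rw [hull_gens hfg']; exact hxρ'
  obtain ⟨c, hc, hcx⟩ := mem_hull_finset_iff.mp hxh
  have hgW : ∀ g ∈ gens ρ', g ∈ tightGens Δ := fun g hg =>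
    Finset.mem_biUnion.mpr ⟨ρ', Δ.finite.mem_toFinset.mpr hρ', hg⟩
  have hgs : ∀ g ∈ gens ρ', g ∈ Δ.support := fun g hg =>
    Fan.mem_support.mpr ⟨ρ', hρ', gens_subset hfg' hg⟩
  -- `M f` is linear on `ρ'`, given by `M a_{ρ'}`
  have hlin : ∀ y ∈ ρ', M * D.f y = (M • D.piece ρ') ⬝ᵥ y := fun y hy => by
    rw [smul_dotProduct, smul_eq_mul, D.eq_piece hρ' hy]
  set δ : (κ → 𝕜) → 𝕜 := fun g => (M • D.piece ρ + D.tightExpose ρ) ⬝ᵥ g - M * D.f g with hδ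
  have hdiff : (M • D.piece ρ + D.tightExpose ρ) ⬝ᵥ x - M * D.f x = ∑ g ∈ gens ρ', c g * δ g := by
    rw [hlin x hxρ', ← sub_dotProduct, ← hcx, dotProduct_sum]
    refine Finset.sum_congr rfl fun g hg => ?_
    rw [dotProduct_smul, smul_eq_mul, sub_dotProduct]
    simp only [hδ, hlin g (gens_subset hfg' hg)]
  have hδnn : ∀ g ∈ gens ρ', 0 ≤ δ g := fun g hg => by
    have := D.tight_le_at_gen_of_le hM hρ (hgW g hg) (hgs g hg)
    rw [hδ]; linarith
  have hsum_nn : 0 ≤ ∑ g ∈ gens ρ', c g * δ g :=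
    Finset.sum_nonneg fun g hg => mul_nonneg (hc g hg) (hδnn g hg)
  refine ⟨by linarith, fun heq => ?_⟩
  have hxD : x ∈ D.domain ρ := by
    by_contra hxD
    have hex : ∃ g ∈ gens ρ', c g ≠ 0 ∧ g ∉ D.domain ρ := by
      by_contra hall
      push Not at hall
      apply hxD
      rw [← hcx]
      refine Submodule.sum_mem _ fun g hg => ?_
      by_cases hcg : c g = 0
      · rw [hcg, zero_smul]; exact Submodule.zero_mem _
      · exact smul_mem_of_nonneg (hall g hg hcg) (hc g hg)
    obtain ⟨g, hg, hcg, hgD⟩ := hex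
    have hpos : 0 < c g * δ g := by
      refine mul_pos (lt_of_le_of_ne (hc g hg) (Ne.symm hcg)) ?_
      have := D.tight_lt_at_gen_of_le hM hρ (hgW g hg) (hgs g hg) hgD
      rw [hδ]; linarith
    have hsum_pos : 0 < ∑ g ∈ gens ρ', c g * δ g :=
      Finset.sum_pos' (fun g hg => mul_nonneg (hc g hg) (hδnn g hg)) ⟨g, hg, hpos⟩
    linarith
  exact ((D.tight_local_of_const M hρ hxD).2).mp heq

/-- **Tightening with a prescribed constant**: for every `M ≥ tightM` the pieces `M a_ρ + ℓ_ρ`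
form tight strict support data (so that, on a fan treated cone by cone, ONE constant can be used
for all cones). [cite: KempfEtAl1973, I §2 Thm. 11 proof (2)] -/
theorem isStrictSupport_tight_of_le {M : 𝕜} (hM : D.tightM ≤ M) :
    Δ.IsStrictSupport fun ρ => M • D.piece ρ + D.tightExpose ρ := by
  intro ρ hρ ρ' hρ' u hu
  have hus : u ∈ Δ.support := Fan.mem_support.mpr ⟨ρ', hρ', hu⟩
  have he : M * D.f u = (M • D.piece ρ' + D.tightExpose ρ') ⬝ᵥ u :=
    ((D.tight_local_of_const M hρ' (D.le_domain hρ' hu)).2).mpr hu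
  obtain ⟨hle, heq⟩ := D.tight_global_of_le hM hρ hus
  rw [he] at hle heq
  exact ⟨hle, heq⟩

/-- The minimum function of the tight pieces with constant `M` is `M f`: on a cone `ρ` the piece of
`ρ` takes the value `M f`. [cite: KempfEtAl1973, I §2 Thm. 10] -/
theorem tight_of_const_eq {M : 𝕜} {ρ : PointedCone 𝕜 (κ → 𝕜)} (hρ : ρ ∈ Δ.cones) {x : κ → 𝕜}
    (hx : x ∈ ρ) : (M • D.piece ρ + D.tightExpose ρ) ⬝ᵥ x = M * D.f x :=
  (((D.tight_local_of_const M hρ (D.le_domain hρ hx)).2).mpr hx).symm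

end Fan.SupportData

/-! ## The tight form of the relative projective refinement over `ℚ` -/

namespace Fan

/-- **[KempfEtAl1973] I §2 Theorem 11 for an arbitrary rational fan, tight form.** Every rational
fan `Δ` in `ℚ^κ` has a regular simplicial refinement `Δ' = Δ.starIter l` by finitely many star
subdivisions through nonzero lattice vectors and ONE function `f ≥ 0` on `ℚ^κ` such that for every
cone `σ` of `Δ`: the cones of `Δ'` inside `σ` cover `σ`, and they carry tight integral strict
support data `m_σ` (`Fan.IsStrictSupport`: on every such cone `τ'` its own piece is the smallest and
ties with the piece of `τ` only on `τ` — "the associated polyhedra" are exactly the cones), all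
pieces non-negative on `σ` (so in the dual monoid `σ^∨ ∩ M`), and the minimum function of `m_σ`
is the SAME global `f` on every `σ` (`⟨m_σ τ, x⟩ = f x` for `x ∈ τ`), so that the cone-wise data
agree on common faces. [cite: KempfEtAl1973, I §2 Thm. 11] -/
theorem exists_regular_refinement_isStrictSupport_cones [DecidableEq κ] (Δ : Fan ℚ (κ → ℚ))
    (hΔ : Δ.IsRational) :
    ∃ l : List (κ → ℚ), (∀ w ∈ l, w ∈ latticeN κ ∧ w ≠ 0) ∧
      (Δ.starIter l).Refines Δ ∧ (Δ.starIter l).IsRegular ∧ (Δ.starIter l).IsSimplicial ∧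
      ∃ f : (κ → ℚ) → ℚ, (∀ x, 0 ≤ f x) ∧
        ∀ ⦃σ : PointedCone ℚ (κ → ℚ)⦄, σ ∈ Δ.cones →
          ((Δ.starIter l).restrict σ).support = (σ : Set (κ → ℚ)) ∧
          ∃ m : PointedCone ℚ (κ → ℚ) → (κ → ℚ),
            ((Δ.starIter l).restrict σ).IsStrictSupport m ∧
            ∀ τ ∈ ((Δ.starIter l).restrict σ).cones,
              m τ ∈ latticeN κ ∧ (∀ x ∈ σ, 0 ≤ m τ ⬝ᵥ x) ∧ (∀ x ∈ τ, m τ ⬝ᵥ x = f x) := by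
  classical
  obtain ⟨l, hl, href, hreg, hsimp, f₀, hnn, h⟩ := Δ.exists_regular_refinement_ordFunction hΔ
  set Δ' := Δ.starIter l with hΔ'
  have h' : ∀ ⦃σ : PointedCone ℚ (κ → ℚ)⦄, σ ∈ Δ.cones → ∃ D : (Δ'.restrict σ).SupportData,
      (Δ'.restrict σ).support = (σ : Set (κ → ℚ)) ∧ D.f = f₀ ∧
        ∀ τ ∈ (Δ'.restrict σ).cones, D.piece τ ∈ latticeN κ := by
    intro σ hσ
    obtain ⟨hsupp, D, hDf, hint⟩ := h hσ
    exact ⟨D, hsupp, hDf, hint⟩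
  choose D hsupp hDf hint using h'
  -- one NATURAL constant `M ≥ tightM` for all cones of `Δ`
  set T := Δ.finite.toFinset with hT
  have hmemT : ∀ {σ}, σ ∈ Δ.cones → σ ∈ T := fun hσ => Δ.finite.mem_toFinset.mpr hσ
  have hTmem : ∀ {σ}, σ ∈ T → σ ∈ Δ.cones := fun hσ => Δ.finite.mem_toFinset.mp hσ
  set B : T → ℚ := fun s => (D (hTmem s.2)).tightM with hB
  have hBnn : ∀ s ∈ T.attach, 0 ≤ B s := fun s _ => (SupportData.tightM_pos _).le
  set M₀ : ℚ := 1 + ∑ s ∈ T.attach, B s with hM₀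
  set M : ℕ := ⌈M₀⌉₊ with hM
  have hM₀M : M₀ ≤ (M : ℚ) := Nat.le_ceil M₀
  have hbig : ∀ {σ} (hσ : σ ∈ Δ.cones), (D hσ).tightM ≤ (M : ℚ) := by
    intro σ hσ
    have h1 : B ⟨σ, hmemT hσ⟩ ≤ ∑ s ∈ T.attach, B s :=
      Finset.single_le_sum hBnn (Finset.mem_attach _ _)
    have h2 : B ⟨σ, hmemT hσ⟩ = (D hσ).tightM := rfl
    rw [← h2]; linarith
  -- the tight pieces per cone and one integer clearing all denominators of the `ℓ_ρ`
  obtain ⟨m, hm⟩ : ∃ m : ∀ ⦃σ : PointedCone ℚ (κ → ℚ)⦄, σ ∈ Δ.cones →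
      PointedCone ℚ (κ → ℚ) → (κ → ℚ),
      ∀ ⦃σ⦄ (hσ : σ ∈ Δ.cones), m hσ = fun ρ => (M : ℚ) • (D hσ).piece ρ + (D hσ).tightExpose ρ :=
    ⟨fun _ hσ ρ => (M : ℚ) • (D hσ).piece ρ + (D hσ).tightExpose ρ, fun _ _ => rfl⟩
  choose N hN hNint using fun σ (hσ : σ ∈ Δ.cones) =>
    Fan.exists_nat_smul_integral (Δ'.restrict σ) (m hσ)
  set P : ℕ := ∏ s ∈ T.attach, N s.1 (hTmem s.2) with hP
  have hPpos : 0 < P := Finset.prod_pos fun s _ => hN s.1 (hTmem s.2)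
  have hPpos' : (0 : ℚ) < P := by exact_mod_cast hPpos
  refine ⟨l, hl, href, hreg, hsimp, fun x => (P : ℚ) * ((M : ℚ) * f₀ x), fun x =>
    mul_nonneg hPpos'.le (mul_nonneg (Nat.cast_nonneg M) (hnn x)), fun σ hσ => ⟨hsupp hσ, ?_⟩⟩
  have hstrict : (Δ'.restrict σ).IsStrictSupport (m hσ) := by
    rw [hm hσ]; exact (D hσ).isStrictSupport_tight_of_le (hbig hσ)
  refine ⟨fun ρ => (P : ℚ) • m hσ ρ, hstrict.smul hPpos', fun τ hτ => ⟨?_, fun x hx => ?_,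
    fun x hx => ?_⟩⟩
  · -- integrality
    have hdvd : N σ hσ ∣ P :=
      Finset.dvd_prod_of_mem (fun s : T => N s.1 (hTmem s.2)) (Finset.mem_attach T ⟨σ, hmemT hσ⟩)
    obtain ⟨k, hk⟩ := hdvd
    show ((P : ℚ) • m hσ τ) ∈ latticeN κ
    rw [hk, Nat.cast_mul, mul_comm, mul_smul]
    have := intCast_smul_mem_latticeN (hNint σ hσ τ hτ) (k : ℤ)
    rwa [Int.cast_natCast] at this
  · -- non-negativity on `σ`: `0 ≤ M f₀ ≤ ⟨m τ, x⟩`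
    have hxs : x ∈ (Δ'.restrict σ).support := by rw [hsupp hσ]; exact hx
    have h1 := ((D hσ).tight_global_of_le (hbig hσ) hτ hxs).1
    rw [hDf hσ] at h1
    show 0 ≤ ((P : ℚ) • m hσ τ) ⬝ᵥ x
    rw [smul_dotProduct, smul_eq_mul, hm hσ]
    exact mul_nonneg hPpos'.le ((mul_nonneg (Nat.cast_nonneg M) (hnn x)).trans h1)
  · -- the minimum function is the global `f`
    show ((P : ℚ) • m hσ τ) ⬝ᵥ x = _
    rw [smul_dotProduct, smul_eq_mul, hm hσ, (D hσ).tight_of_const_eq hτ hx, hDf hσ]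

end Fan

end Literature.Geometry.PolyhedralFans

end
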